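import Summits.RiemannHypothesis.RiemannHypothesis.Theses.WeilGroundState
import Summits.RiemannHypothesis.RiemannHypothesis.Theorems.WeilGroundStateGroundStatesConvergeToXiRenormBlowup
import Summits.RiemannHypothesis.RiemannHypothesis.Theorems.WeilGroundStateGroundStatesConvergeToXiEnergyBddBelow
import Summits.RiemannHypothesis.RiemannHypothesis.Theorems.GronwallLeakage.Negative.LoadBearing
import Literature.NumberTheory.LFunctions.WeilExplicit
import Literature.NumberTheory.LFunctions.WeilExplicitFormulaProofs
import Literature.NumberTheory.LFunctions.WeilCriterionConverse
import Literature.NumberTheory.LFunctions.WeilZeroSum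
import Literature.NumberTheory.LFunctions.WeilGroundState
import Literature.NumberTheory.LFunctions.WeilGroundStateRealZerosProofs
import HarnessLib

/-!
# RiemannHypothesis / WeilGroundState — the crux forbids finitely many exceptions to RH
(zero side of the variational problem; parity-free)

Route `RiemannHypothesis/WeilGroundState`, crux item stmt-RiemannHypothesis-1527
(`GroundStatesConvergeToXi`), line `Sketch`, continuation lead c4 (helper file, `--supports`).

Leads c1–c3 proved, on the GEOMETRIC side of the explicit formula, that a witness of the crux
implies RH as soon as its renormalisation constants `c_k` (or its renormalised `L¹` masses) stay
bounded, and that under `¬RH` every crux witness degenerates: `‖c_k‖ → ∞` and the normalised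
ground states' transforms `û_k → 0` locally uniformly on the open strip
(`tendstoLocallyUniformlyOn_weilMellin_zero_of_not_riemannHypothesis`).  This file opens the ZERO
SIDE (the tree PROVES the Guinand–Weil explicit formula, `explicit_formula_holds`, and holds
Bombieri's zero-side form `WeilConverse.zeroForm g = Σ_ρ m(ρ) ĝ(ρ) conj ĝ(1-ρ̄)`), and proves a
parity-free consequence of the crux VERBATIM:

* `re_weilQuadratic_ge_neg_sum_offLine` — for a test function `g` and any finite set `S` of
  non-trivial zeros containing all the zeros OFF the critical line,
  `Re Q(g) ≥ -Σ_{ρ ∈ S} ‖m(ρ) ĝ(ρ) conj ĝ(1-ρ̄)‖`: on the line `1 - ρ̄ = ρ`, so every on-line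
  term of the zero side is `m(ρ)|ĝ(ρ)|² ≥ 0` and may be dropped.
* `neg_sum_offLine_le_weilGroundEnergy` — hence for every ground state `u` at a window `a`
  (operator-free `IsWeilGroundState`), `ε(a) ≥ -Σ_{ρ ∈ S} ‖m(ρ) û(ρ) conj û(1-ρ̄)‖` (pass to the
  `L²`-limit along the minimising sequence; `ĝₙ(ρ) → û(ρ)`).
* `riemannHypothesis_of_cruxWitness_of_offLine_finite` — **a witness of the crux together with
  finiteness of the set of off-line non-trivial zeros proves RH**: under `¬RH`, `û_k → 0` at the
  finitely many points `ρ, 1-ρ̄` (all in the open strip), so the lower bound tends to `0` along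
  the witness windows `a_k → ∞`; `ε` is antitone, hence bounded below on `(0, ∞)`, hence RH
  (`riemannHypothesis_of_weilGroundEnergy_bddBelow`) — contradiction.
* `riemannHypothesis_or_offLine_infinite_of_groundStatesConvergeToXi` — **the crux implies:
  RH, or there are INFINITELY MANY zeros of `ζ` off the critical line**; and
  `exists_offLine_im_gt_of_not_riemannHypothesis` — under `¬RH` a crux witness forces off-line
  zeros of arbitrarily large height.

So the one regime of "crux ⇒ RH verbatim" left open by c3 (minimisers living at escaping
frequencies) provably REQUIRES infinitely many off-critical zeros of unbounded height: a single
off-line zero (or any finite configuration) is incompatible with the crux.  No parity hypothesis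
(`GroundStateSimpleEven`), no Connes–van Suijlekom theorem and no Hurwitz argument enter.

Mathlib + proved tree material only; no named fact; no definitions; standard axioms.
-/

set_option linter.dupNamespace false

noncomputable section

open MeasureTheory Complex Filter Set
open scoped Real Topology ComplexConjugate

namespace Summit.RiemannHypothesis.RiemannHypothesis.Theorems.GroundStatesConvergeToXi

open Literature.NumberTheory.LFunctions
open Summit.RiemannHypothesis.Cruxes.GronwallLeakage.Negative

/-! ### On-line terms of the zero side are non-negative -/

/-- For a zero on the critical line, the zero-side term `m(ρ) P_g(ρ) = m(ρ) |ĝ(ρ)|²` has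
non-negative real part (any `g`; on the line the reflection `ρ ↦ 1 - ρ̄` is the identity and
`m(ρ) ≥ 1` on the non-trivial zeros). [folklore] -/
theorem re_order_mul_pairCoeff_nonneg_of_re_eq_half (g : ℝ → ℂ) {ρ : ℂ}
    (hρ : ρ ∈ ZetaZeros.riemannZetaNontrivialZeros) (hre : ρ.re = 1 / 2) :
    0 ≤ ((riemannZetaZeroOrder ρ : ℂ) * WeilConverse.pairCoeff g ρ).re := by
  have hm : (0 : ℝ) ≤ riemannZetaZeroOrder ρ := by
    have := ZetaZeros.riemannZetaNontrivialZeros.one_le_order hρ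
    exact_mod_cast (by omega : (0 : ℤ) ≤ riemannZetaZeroOrder ρ)
  have hrefl : 1 - conj ρ = ρ := by
    apply Complex.ext
    · simp only [sub_re, one_re, conj_re]; linarith
    · simp only [sub_im, one_im, conj_im]; ring
  rw [WeilConverse.pairCoeff, hrefl, Complex.mul_conj]
  have e : ((riemannZetaZeroOrder ρ : ℂ) * (Complex.normSq (weilMellin g ρ) : ℂ)).re =
      (riemannZetaZeroOrder ρ : ℝ) * Complex.normSq (weilMellin g ρ) := by
    simp [Complex.mul_re]
  rw [e]
  exact mul_nonneg hm (Complex.normSq_nonneg _)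

/-! ### Zero-side lower bound for test functions -/

/-- **Zero-side lower bound.**  For a test function `g` and a finite set `S` of non-trivial zeros
containing every zero off the critical line,
`-Σ_{ρ ∈ S} ‖m(ρ) P_g(ρ)‖ ≤ Re Q(g)`, `P_g(ρ) = ĝ(ρ) conj ĝ(1-ρ̄)`.
Proof: `Q(g) = Σ_ρ m(ρ) P_g(ρ)` (explicit formula `explicit_formula_holds` + Bombieri's zero-side
form `WeilConverse.hasWeilZeroSide_zeroForm`, uniqueness of limits); split the absolutely
convergent sum into `S` and its complement; off `S` every zero is on the line and contributes
`m(ρ)|ĝ(ρ)|² ≥ 0`; on `S` use `Re z ≥ -‖z‖`. [folklore] -/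
theorem re_weilQuadratic_ge_neg_sum_offLine {g : ℝ → ℂ} (hg : IsWeilTest g)
    (S : Finset ZetaZeros.riemannZetaNontrivialZeros)
    (hS : ∀ ρ : ZetaZeros.riemannZetaNontrivialZeros, (ρ : ℂ).re ≠ 1 / 2 → ρ ∈ S) :
    -(∑ ρ ∈ S, ‖(riemannZetaZeroOrder (ρ : ℂ) : ℂ) * WeilConverse.pairCoeff g ρ‖) ≤
      (weilQuadratic g).re := by
  classical
  have hQ : WeilConverse.zeroForm g = weilQuadratic g :=
    tendsto_nhds_unique (WeilConverse.hasWeilZeroSide_zeroForm hg)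
      (explicit_formula_holds (hg.weilConv hg.weilReflect))
  set f : ZetaZeros.riemannZetaNontrivialZeros → ℂ :=
    fun ρ ↦ (riemannZetaZeroOrder (ρ : ℂ) : ℂ) * WeilConverse.pairCoeff g ρ with hf
  have hsum : Summable f := WeilConverse.summable_pairCoeff hg
  have hre : (weilQuadratic g).re = ∑' ρ, (f ρ).re := by
    rw [← hQ, WeilConverse.zeroForm, Complex.re_tsum hsum]
  have hsumre : Summable fun ρ ↦ (f ρ).re := (Complex.hasSum_re hsum.hasSum).summable
  -- split off the finite set `S`
  have hsplit := hsumre.sum_add_tsum_compl (s := S)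
  -- the complement carries only on-line zeros
  have hcompl : 0 ≤ ∑' ρ : ↥((S : Set ZetaZeros.riemannZetaNontrivialZeros)ᶜ), (f ρ).re := by
    refine tsum_nonneg fun ρ ↦ ?_
    have hρS : (ρ : ZetaZeros.riemannZetaNontrivialZeros) ∉ S := fun h ↦ ρ.2 (Finset.mem_coe.2 h)
    have hline : ((ρ : ZetaZeros.riemannZetaNontrivialZeros) : ℂ).re = 1 / 2 := by
      by_contra h
      exact hρS (hS _ h)
    exact re_order_mul_pairCoeff_nonneg_of_re_eq_half g
      (ρ : ZetaZeros.riemannZetaNontrivialZeros).2 hline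
  -- the finite part
  have hfin : -(∑ ρ ∈ S, ‖f ρ‖) ≤ ∑ ρ ∈ S, (f ρ).re := by
    rw [← Finset.sum_neg_distrib]
    exact Finset.sum_le_sum fun ρ _ ↦ (abs_le.1 (Complex.abs_re_le_norm (f ρ))).1
  rw [hre, ← hsplit]
  linarith

/-! ### Passing to a ground state -/

/-- Along an `L²`-convergent sequence of window test functions `gₙ → u` (`u` a ground state at
window `a`), the pairing coefficients converge: `P_{gₙ}(ρ) → P_u(ρ)`. [folklore] -/
theorem tendsto_pairCoeff {a : ℝ} {u : ℝ → ℂ} (hu : IsWeilGroundState a u) {g : ℕ → ℝ → ℂ}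
    (hg : ∀ n, IsWeilTest (g n) ∧ tsupport (g n) ⊆ Icc (-a) a)
    (hL : Tendsto (fun n ↦ ∫ t, ‖g n t - u t‖ ^ 2) atTop (𝓝 0)) (ρ : ℂ) :
    Tendsto (fun n ↦ WeilConverse.pairCoeff (g n) ρ) atTop (𝓝 (WeilConverse.pairCoeff u ρ)) := by
  unfold WeilConverse.pairCoeff
  exact (ConnesVanSuijlekom.tendsto_weilMellin hu hg hL ρ).mul
    ((Complex.continuous_conj.tendsto _).comp
      (ConnesVanSuijlekom.tendsto_weilMellin hu hg hL (1 - conj ρ)))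

/-- **The energy of a ground state is bounded below by minus its finite off-line pairing.**
For every ground state `u` at a window `a` and every finite set `S` of non-trivial zeros
containing all zeros off the critical line,
`-Σ_{ρ ∈ S} ‖m(ρ) û(ρ) conj û(1-ρ̄)‖ ≤ ε(a)`.
(Lower semicontinuity is not needed: the bound for the minimising sequence passes to the limit
termwise on the finite set.) [folklore] -/
theorem neg_sum_offLine_le_weilGroundEnergy {a : ℝ} {u : ℝ → ℂ} (hu : IsWeilGroundState a u)
    (S : Finset ZetaZeros.riemannZetaNontrivialZeros)
    (hS : ∀ ρ : ZetaZeros.riemannZetaNontrivialZeros, (ρ : ℂ).re ≠ 1 / 2 → ρ ∈ S) :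
    -(∑ ρ ∈ S, ‖(riemannZetaZeroOrder (ρ : ℂ) : ℂ) * WeilConverse.pairCoeff u ρ‖) ≤
      weilGroundEnergy a := by
  obtain ⟨_, g, hg, hQ, hL⟩ := id hu
  have hT : Tendsto (fun n ↦ -(∑ ρ ∈ S, ‖(riemannZetaZeroOrder (ρ : ℂ) : ℂ) *
      WeilConverse.pairCoeff (g n) ρ‖)) atTop
      (𝓝 (-(∑ ρ ∈ S, ‖(riemannZetaZeroOrder (ρ : ℂ) : ℂ) * WeilConverse.pairCoeff u ρ‖))) := by
    refine (tendsto_finsetSum S fun ρ _ ↦ ?_).neg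
    exact ((tendsto_pairCoeff hu (fun n ↦ ⟨(hg n).1, (hg n).2.1⟩) hL ρ).const_mul _).norm
  exact le_of_tendsto_of_tendsto' hT hQ fun n ↦
    re_weilQuadratic_ge_neg_sum_offLine (hg n).1 S hS

/-! ### The crux and finitely many off-line zeros -/

/-- The finite set of off-line non-trivial zeros, as a `Finset` of the subtype, from finiteness
of `{ρ non-trivial | Re ρ ≠ 1/2}`. [folklore] -/
theorem exists_finset_offLine
    (hfin : {ρ : ℂ | ρ ∈ ZetaZeros.riemannZetaNontrivialZeros ∧ ρ.re ≠ 1 / 2}.Finite) :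
    ∃ S : Finset ZetaZeros.riemannZetaNontrivialZeros,
      ∀ ρ : ZetaZeros.riemannZetaNontrivialZeros, (ρ : ℂ).re ≠ 1 / 2 → ρ ∈ S := by
  have h : (Subtype.val ⁻¹' {ρ : ℂ | ρ ∈ ZetaZeros.riemannZetaNontrivialZeros ∧ ρ.re ≠ 1 / 2} :
      Set ZetaZeros.riemannZetaNontrivialZeros).Finite :=
    hfin.preimage Subtype.val_injective.injOn
  refine ⟨h.toFinset, fun ρ hρ ↦ ?_⟩
  rw [Set.Finite.mem_toFinset]
  exact ⟨ρ.2, hρ⟩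

/-- **A crux witness with finitely many off-line zeros proves RH.**  Let `a_k → ∞`, `u_k` ground
states at the windows `a_k` and `c_k` scalars with `c_k · weilMellin u_k → ξ` locally uniformly
on the open critical strip (the shape of `GroundStatesConvergeToXi`; `c_k ≠ 0` is not needed).
If the set of non-trivial zeros off the critical line is finite, the Riemann hypothesis holds.
Proof: under `¬RH` the normalised transforms collapse, `û_k → 0` locally uniformly on the strip
(`tendstoLocallyUniformlyOn_weilMellin_zero_of_not_riemannHypothesis`), in particular at the
finitely many points `ρ`, `1 - ρ̄` (`ρ` off-line); so the lower bound of
`neg_sum_offLine_le_weilGroundEnergy` tends to `0` along `a_k`; `ε` antitone ⇒ `ε ≥ -1` on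
`(0, ∞)` ⇒ RH (`riemannHypothesis_of_weilGroundEnergy_bddBelow`), absurd. [folklore] -/
theorem riemannHypothesis_of_cruxWitness_of_offLine_finite
    {a : ℕ → ℝ} {u : ℕ → ℝ → ℂ} {c : ℕ → ℂ}
    (ha : Tendsto a atTop atTop) (hu : ∀ k, IsWeilGroundState (a k) (u k))
    (hlim : TendstoLocallyUniformlyOn (fun k s => c k * weilMellin (u k) s) riemannXi atTop
      {s : ℂ | 0 < s.re ∧ s.re < 1})
    (hfin : {ρ : ℂ | ρ ∈ ZetaZeros.riemannZetaNontrivialZeros ∧ ρ.re ≠ 1 / 2}.Finite) :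
    RiemannHypothesis := by
  by_contra hRH
  have h0 := tendstoLocallyUniformlyOn_weilMellin_zero_of_not_riemannHypothesis hRH ha hu hlim
  obtain ⟨S, hS⟩ := exists_finset_offLine hfin
  -- the finite off-line pairing of `u_k` tends to `0`
  set F : ℕ → ℝ := fun k ↦ ∑ ρ ∈ S, ‖(riemannZetaZeroOrder (ρ : ℂ) : ℂ) *
    WeilConverse.pairCoeff (u k) ρ‖ with hF
  have hmem : ∀ ρ : ZetaZeros.riemannZetaNontrivialZeros,
      (ρ : ℂ) ∈ {s : ℂ | 0 < s.re ∧ s.re < 1} ∧ (1 - conj (ρ : ℂ)) ∈ {s : ℂ | 0 < s.re ∧ s.re < 1} := by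
    intro ρ
    have h1 := ZetaZeros.riemannZetaNontrivialZeros.re_pos ρ.2
    have h2 := ZetaZeros.riemannZetaNontrivialZeros.re_lt_one ρ.2
    refine ⟨⟨h1, h2⟩, ?_, ?_⟩
    · simp only [sub_re, one_re, conj_re]; linarith
    · simp only [sub_re, one_re, conj_re]; linarith
  have hFlim : Tendsto F atTop (𝓝 0) := by
    have h : Tendsto F atTop (𝓝 (∑ ρ ∈ S, ‖(riemannZetaZeroOrder (ρ : ℂ) : ℂ) * (0 * conj 0)‖)) := by
      refine tendsto_finsetSum S fun ρ _ ↦ ?_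
      refine (Tendsto.const_mul _ ?_).norm
      exact (h0.tendsto_at (hmem ρ).1).mul
        ((Complex.continuous_conj.tendsto _).comp (h0.tendsto_at (hmem ρ).2))
    simpa using h
  -- `ε ≥ -1` on `(0, ∞)`
  have hbdd : ∀ b : ℝ, 0 < b → -1 ≤ weilGroundEnergy b := by
    intro b hb
    have h1 : ∀ᶠ k in atTop, F k ≤ 1 := by
      have := hFlim.eventually (eventually_le_nhds (show (0 : ℝ) < 1 by norm_num))
      exact this
    obtain ⟨k, hk1, hk2⟩ := (h1.and (ha.eventually (eventually_ge_atTop b))).exists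
    calc (-1 : ℝ) ≤ -F k := by linarith
      _ ≤ weilGroundEnergy (a k) := neg_sum_offLine_le_weilGroundEnergy (hu k) S hS
      _ ≤ weilGroundEnergy b := weilGroundEnergy_antitone_of_pos hb hk2
  exact hRH (riemannHypothesis_of_weilGroundEnergy_bddBelow ⟨-1, hbdd⟩)

/-- **The crux with finitely many off-line zeros proves RH** (`GroundStatesConvergeToXi` form: its
window clause is `IsWeilGroundState` unfolded). [folklore] -/
theorem riemannHypothesis_of_groundStatesConvergeToXi_of_offLine_finite
    (h : Summit.RiemannHypothesis.RiemannHypothesis.Theses.WeilGroundState.GroundStatesConvergeToXi)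
    (hfin : {ρ : ℂ | ρ ∈ ZetaZeros.riemannZetaNontrivialZeros ∧ ρ.re ≠ 1 / 2}.Finite) :
    RiemannHypothesis := by
  obtain ⟨a, u, c, ha, hk, hlim⟩ := h
  exact riemannHypothesis_of_cruxWitness_of_offLine_finite ha
    (fun k => ⟨(hk k).2.2.1, (hk k).2.2.2⟩) hlim hfin

/-- **Dichotomy forced by the crux (parity-free).**  `GroundStatesConvergeToXi` implies: the
Riemann hypothesis holds, OR `ζ` has infinitely many zeros off the critical line.  In particular
the crux is incompatible with any FINITE non-empty set of exceptions to RH. [folklore] -/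
theorem riemannHypothesis_or_offLine_infinite_of_groundStatesConvergeToXi
    (h : Summit.RiemannHypothesis.RiemannHypothesis.Theses.WeilGroundState.GroundStatesConvergeToXi) :
    RiemannHypothesis ∨
      {ρ : ℂ | ρ ∈ ZetaZeros.riemannZetaNontrivialZeros ∧ ρ.re ≠ 1 / 2}.Infinite := by
  by_cases hfin : {ρ : ℂ | ρ ∈ ZetaZeros.riemannZetaNontrivialZeros ∧ ρ.re ≠ 1 / 2}.Finite
  · exact Or.inl (riemannHypothesis_of_groundStatesConvergeToXi_of_offLine_finite h hfin)
  · exact Or.inr hfin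

/-- **Under `¬RH` a crux witness forces off-line zeros of arbitrarily large height**: for every
`T` there is a non-trivial zero `ρ` with `Re ρ ≠ 1/2` and `|Im ρ| > T` (the zeros of `ζ` in a
bounded part of the closed strip are finite in number, `weilZeroIndex_finite`). [folklore] -/
theorem exists_offLine_im_gt_of_not_riemannHypothesis (hRH : ¬ RiemannHypothesis)
    {a : ℕ → ℝ} {u : ℕ → ℝ → ℂ} {c : ℕ → ℂ}
    (ha : Tendsto a atTop atTop) (hu : ∀ k, IsWeilGroundState (a k) (u k))
    (hlim : TendstoLocallyUniformlyOn (fun k s => c k * weilMellin (u k) s) riemannXi atTop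
      {s : ℂ | 0 < s.re ∧ s.re < 1}) (T : ℝ) :
    ∃ ρ : ℂ, ρ ∈ ZetaZeros.riemannZetaNontrivialZeros ∧ ρ.re ≠ 1 / 2 ∧ T < |ρ.im| := by
  by_contra hne
  push Not at hne
  refine hRH (riemannHypothesis_of_cruxWitness_of_offLine_finite ha hu hlim ?_)
  refine (weilZeroIndex_finite T).subset ?_
  rintro ρ ⟨hρ, hre⟩
  exact ⟨ZetaZeros.riemannZetaNontrivialZeros.zeta_eq_zero hρ,
    (ZetaZeros.riemannZetaNontrivialZeros.re_pos hρ).le,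
    (ZetaZeros.riemannZetaNontrivialZeros.re_lt_one hρ).le,
    ZetaZeros.riemannZetaNontrivialZeros.im_ne_zero hρ, hne ρ hρ hre⟩

/-- **Under `¬RH` a crux witness forces infinitely many off-line zeros.** [folklore] -/
theorem offLine_infinite_of_not_riemannHypothesis (hRH : ¬ RiemannHypothesis)
    {a : ℕ → ℝ} {u : ℕ → ℝ → ℂ} {c : ℕ → ℂ}
    (ha : Tendsto a atTop atTop) (hu : ∀ k, IsWeilGroundState (a k) (u k))
    (hlim : TendstoLocallyUniformlyOn (fun k s => c k * weilMellin (u k) s) riemannXi atTop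
      {s : ℂ | 0 < s.re ∧ s.re < 1}) :
    {ρ : ℂ | ρ ∈ ZetaZeros.riemannZetaNontrivialZeros ∧ ρ.re ≠ 1 / 2}.Infinite :=
  fun hfin ↦ hRH (riemannHypothesis_of_cruxWitness_of_offLine_finite ha hu hlim hfin)

end Summit.RiemannHypothesis.RiemannHypothesis.Theorems.GroundStatesConvergeToXi

end
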